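import Literature.AlgebraicGeometry.Resolution.PointBlowupGiraudForm
import HarnessLib

/-!
# REVIEW-RUNBOOK sanity lemmas — the cofactors chosen in `Giraud1983.finitePartGens` are DETERMINED (away from the zero form)
# (client `pub-rosobs` of the ops review-runbook generator; §2 card `Literature.AlgebraicGeometry.Resolution.Giraud1983.finitePartGens`)

`finitePartGens a b = (Classical.choose (gcdPair_dvd_left a b), Classical.choose (gcdPair_dvd_right a b))`: the cofactors `c₁, c₂`
with `a = gcd(a,b)·c₁`, `b = gcd(a,b)·c₂` in the UFD `K[y,z]`.  `Classical.choose` returns SOME witness of the divisibility; the value is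
well defined exactly when the witness is unique, i.e. when `gcd(a,b) ≠ 0` — which holds unless `a = b = 0` (the docstring's «for `a = b = 0`
the gcd is `0` and the cofactors are unspecified junk — the zero form has no finite part»).  This file proves the uniqueness under
`¬(a = 0 ∧ b = 0)`, by cancellation in the domain `K[y,z]`.

Review evidence only (topic module, closes no item); no definitions, no `sorry`, standard axioms.
-/

namespace Summit.ResolutionOfSingularities.KangarooAtlas.Runbook

open Literature.AlgebraicGeometry.Resolution.Giraud1983

/-- `gcd(a, b) ≠ 0` unless `a = b = 0` (a common divisor of a non-zero element is non-zero). [folklore] -/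
theorem gcdPair_ne_zero {K : Type*} [Field K] {a b : A K} (h : ¬(a = 0 ∧ b = 0)) : gcdPair a b ≠ 0 :=
  fun h0 => h ⟨zero_dvd_iff.mp (h0 ▸ gcdPair_dvd_left a b), zero_dvd_iff.mp (h0 ▸ gcdPair_dvd_right a b)⟩

/-- (c) **The first cofactor is unique** away from the zero form: `a = gcd(a,b)·c = gcd(a,b)·c' ⇒ c = c'` under `¬(a = 0 ∧ b = 0)` —
the `Classical.choose (gcdPair_dvd_left a b)` in `finitePartGens` does not depend on the choice there. [folklore] -/
theorem finitePartGens_fst_spec_unique {K : Type*} [Field K] (a b : A K) (h : ¬(a = 0 ∧ b = 0)) (c c' : A K)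
    (hc : a = gcdPair a b * c) (hc' : a = gcdPair a b * c') : c = c' :=
  mul_left_cancel₀ (gcdPair_ne_zero h) (hc.symm.trans hc')

/-- (c) **The second cofactor is unique** away from the zero form: `b = gcd(a,b)·c = gcd(a,b)·c' ⇒ c = c'` under `¬(a = 0 ∧ b = 0)`.
[folklore] -/
theorem finitePartGens_snd_spec_unique {K : Type*} [Field K] (a b : A K) (h : ¬(a = 0 ∧ b = 0)) (c c' : A K)
    (hc : b = gcdPair a b * c) (hc' : b = gcdPair a b * c') : c = c' :=
  mul_left_cancel₀ (gcdPair_ne_zero h) (hc.symm.trans hc')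

end Summit.ResolutionOfSingularities.KangarooAtlas.Runbook
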